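import Summits.BirchSwinnertonDyer.BirchSwinnertonDyer.Theorems.GenusKolyvaginAtTwoGenusPrimitiveSupplyAtTwoTwistMultiFrame
import Summits.BirchSwinnertonDyer.BirchSwinnertonDyer.Theorems.GenusKolyvaginAtTwoGenusPrimitiveSupplyAtTwoArchimedeanUnramifiedFrame
import HarnessLib

/-!
# Route `GenusKolyvaginAtTwo`, crux #2 `GenusPrimitiveSupplyAtTwo` (stmt-BirchSwinnertonDyer-22136):
# MAZUR–RUBIN PROP. 3.3 (the `V_T`-free consequences) WITH FINITE AND REAL `T`-PLACES AT ONCE, `T`-primes of ANY `2`-torsion rank,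
# FIVE-row finite menu — `2^{−(Σ e_v + #R)}·#Sel₂(W) ≤ #Sel₂(Wd) ≤ 2^{Σ e_v + #R}·#Sel₂(W)` and the parity, unconditionally, every number field

Width seat `bsd-line-gk2-p5` g12 (cell `bsd-f1-sign2`, SUPPLY lineage), file 50 of the series: sequel of `…TwistMasterFrame` (§97) /
`…ArchimedeanUnramifiedFrame` (§98) and of gk2-p4 g12's `…TwistMultiFrame` (§80 the elementary transfer bound, §82 Prop. 3.3 bounds for a
finite set of FINITE `T`-places with `#W(K_v)[2] = 2` and the FOUR-row menu, every infinite place on the two-row menu). THEOREMS ONLY (no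
definition, no named fact, no `sorry`, no local instance); helper `--supports stmt-BirchSwinnertonDyer-22136`; no item is closed; BSD is
not proved by any of this.

WHAT. §82 cannot take a REAL `T`-place (`d < 0` at a real `w` with `w(Δ_W) > 0`: the two Kummer lines at `w` are transverse, Kramer
Prop. 6), nor a `T`-prime with `W(K_v)[2] = W[2]` (fully split `2`-torsion, `dim H¹_f = 2`), nor a dyadic non-`T` place that is inert in
`K(√d)`. With the master datum all three restrictions go:

* §112 `embedding_Δ_pos_of_smul_quadraticTwist` — `w(Δ_{Wd}) > 0 ⟺ w(Δ_W) > 0` for a twist model (`Δ_{Wd} = u⁻¹² d⁶ Δ_W`);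
* §113 **`natCard_selmerGroup_twist_bounds_mixed`** — `W/K` elliptic, `Wd = C • W^{(d)}`; `T` a finite set of places `v ∤ 2` good for
  `W` and RAMIFIED in `K(√d)`, with `#W(K_v)[2] = 2^{e_v}` (ANY `e_v ∈ {0,1,2}`); `R` a finite set of REAL places with `w(Δ_W) > 0` and
  `d ∉ K_w²`; every finite `v ∉ T` on the FIVE-row menu; every infinite `w ∉ R` split or `H¹ = 0` for both. Then with
  `n := Σ_{v∈T} e_v + #R`: `#Sel₂(Wd) ≤ 2ⁿ·#Sel₂(W)`, `#Sel₂(W) ≤ 2ⁿ·#Sel₂(Wd)`, and `#Sel₂(Wd)·#Sel₂(W)·2ⁿ` is a square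
  (`d₂(Wd) ≡ d₂(W) + n (mod 2)`, `|d₂(Wd) − d₂(W)| ≤ n`) — Prop. 3.3's `d₂(E^F) = d₂(E) − dim V_T + d`, `0 ≤ d ≤ Σ h_v − dim V_T`,
  `d ≡ Σ h_v − dim V_T` with the `V_T`-dependence removed, for the archimedean `T`-places of Kramer / MR Prop. 5.3 as well. UNCONDITIONAL
  (PT with real places, Tate χ, Lemma 2.11, Kramer Prop. 6, Kramer's congruence for the framed identification — all tree theorems);
* §114 `natCard_selmerGroup_twist_bounds_rat_of_Δ_pos` — over `ℚ` with `Δ_W > 0`, `d < 0`: `R = {∞}` automatically, so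
  `n = Σ_{v∈T} e_v + 1`.

References: [MazurRubin2010] Thm. 2.7, Lemmas 2.2 (i), 2.9–2.11, Def. 3.1, Prop. 3.3, proof of Prop. 5.3; [Kramer1981] Thm. 1, Props. 1–3, 6, 7;
[KlagsbrunMazurRubin2013] Thm. 3.9, Lemma 5.2; [MilneADT2006] I Lemma 3.3, Thm. 2.8, 2.13, 4.10.
-/

set_option linter.dupNamespace false -- tree convention: `Summit.BirchSwinnertonDyer.BirchSwinnertonDyer.Theorems` (summit = sub-problem)
set_option autoImplicit false

noncomputable section

open scoped Classical ContRepresentation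

namespace Summit.BirchSwinnertonDyer.BirchSwinnertonDyer.Theorems.GenusKolyTwistLocal

open WeierstrassCurve Field NumberField IsDedekindDomain Function
open Literature.NumberTheory.EllipticCurves Literature.NumberTheory.GaloisRepresentations
open Literature.NumberTheory.EllipticCurves.DokchitserDokchitser2012 (T xT)
open Literature.NumberTheory.GaloisRepresentations.IsNonarchimedeanLocalField
open Literature.NumberTheory.GaloisRepresentations.DiscreteGaloisModule (SelmerStructure)
open Literature.NumberTheory.GaloisCohomology
open Summit.BirchSwinnertonDyer.Rank1Residual.X11b
open Summit.BirchSwinnertonDyer.Rank1Residual.X11b.CongruentTransfer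
open Summit.BirchSwinnertonDyer.BirchSwinnertonDyer.Theorems.GenusKolyTwistTamagawa (transport_twist_agree_inl_of_menu)
open Summit.BirchSwinnertonDyer.BirchSwinnertonDyer.Theorems.GenusKolyArch
  (transport_twist_agree_inr_of_menu₅ natCard_ker_nsmul_eq_of_intertwining natCard_kummerSelmerStructure_inl_eq_two_of_isReal
    forall_sq_ne_completion_of_neg embedding_of_isReal_rat_apply)

section Mixed

variable {K : Type} [Field K] [NumberField K] (W Wd : WeierstrassCurve K) [W.IsElliptic] [Wd.IsElliptic]

/-! ## §112 The sign of the discriminant of a twist model at a real place -/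

omit [W.IsElliptic] [Wd.IsElliptic] in
/-- **`w(Δ_{Wd}) > 0` for a twist model `Wd = C • W^{(d)}` at a real place `w` with `w(Δ_W) > 0`**: `Δ_{Wd} = u⁻¹² · d⁶ · Δ_W` with `u, d ≠ 0`.
[cite: SilvermanAEC2009, X.5 Cor. 5.4, III.1 Table 3.1] -/
theorem embedding_Δ_pos_of_smul_quadraticTwist {d : K} (hd : d ≠ 0) {C : VariableChange K} (hWd : C • W.quadraticTwist d = Wd)
    {w : InfinitePlace K} (hw : w.IsReal) (hΔ : 0 < InfinitePlace.embedding_of_isReal hw W.Δ) :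
    0 < InfinitePlace.embedding_of_isReal hw Wd.Δ := by
  rw [← hWd, variableChange_Δ, quadraticTwist_Δ, map_mul, map_mul, map_pow, map_pow]
  have hu : (0 : ℝ) < InfinitePlace.embedding_of_isReal hw ((C.u⁻¹ : Kˣ) : K) ^ 12 := by
    have hne : InfinitePlace.embedding_of_isReal hw ((C.u⁻¹ : Kˣ) : K) ≠ 0 :=
      (map_ne_zero (InfinitePlace.embedding_of_isReal hw)).mpr (Units.ne_zero _)
    rw [show (12 : ℕ) = 2 * 6 from rfl, pow_mul]
    exact pow_pos (lt_of_le_of_ne (sq_nonneg _) (Ne.symm (pow_ne_zero 2 hne))) 6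
  have hd6 : (0 : ℝ) < InfinitePlace.embedding_of_isReal hw d ^ 6 := by
    have hne : InfinitePlace.embedding_of_isReal hw d ≠ 0 := (map_ne_zero (InfinitePlace.embedding_of_isReal hw)).mpr hd
    rw [show (6 : ℕ) = 2 * 3 from rfl, pow_mul]
    exact pow_pos (lt_of_le_of_ne (sq_nonneg _) (Ne.symm (pow_ne_zero 2 hne))) 3
  exact mul_pos hu (mul_pos hd6 hΔ)

/-! ## §113 Prop. 3.3's bounds with finite and real `T`-places, any `2`-torsion rank, five-row menu -/

/-- **MAZUR–RUBIN PROP. 3.3 (the `V_T`-free consequences) WITH FINITE AND REAL `T`-PLACES — UNCONDITIONAL, every number field, every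
elliptic `W`.** Data: `Wd = C • W^{(d)}`; a finite set `T` of places `v ∤ 2` of good reduction for `W`, each RAMIFIED in `K(√d)`, with
`#W(K_v)[2] = 2^{e_v}` (any `e_v`); a finite set `R` of REAL places `w` with `w(Δ_W) > 0` at which `d` is not a square; every finite `v ∉ T`
on the FIVE-row menu (split ∨ `v ∤ 2` Tamagawa-odd both ∨ `v ∤ 2` good both ∨ `v ∤ 2` silent both ∨ unramified semistable, any residue
characteristic); every infinite `w ∉ R` split or with `H¹ = 0` for both. Conclusion, with `n = Σ_{v∈T} e_v + #R`:
`#Sel₂(Wd) ≤ 2ⁿ·#Sel₂(W)`, `#Sel₂(W) ≤ 2ⁿ·#Sel₂(Wd)`, `IsSquare (#Sel₂(Wd)·#Sel₂(W)·2ⁿ)`. The inequalities are §80 (each `T`-place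
contributes `#𝓐_v = #𝓚_v = 2^{e_v}`, each `R`-place `2`); the parity is Kramer's congruence for the framed master identification with
`[𝓚_v : 𝓐_v ⊓ 𝓚_v] = #𝓚_v` by Lemma 2.11 (finite) and Kramer Prop. 6 (real).
[cite: MazurRubin2010, Prop. 3.3 with Lemmas 2.2 (i), 2.9–2.11; proof of Prop. 5.3] [cite: Kramer1981, Thm. 1, Prop. 6]
[cite: MilneADT2006, I Lemma 3.3, Thm. 2.8, 4.10] -/
theorem natCard_selmerGroup_twist_bounds_mixed {d : K} (hd : d ≠ 0) {C : VariableChange K}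
    (hWd : C • W.quadraticTwist d = Wd) (T : Finset (HeightOneSpectrum (𝓞 K))) (e : HeightOneSpectrum (𝓞 K) → ℕ)
    (R : Finset (InfinitePlace K))
    (hT2 : ∀ v ∈ T, ((2 : ℕ) : 𝓞 K) ∉ v.asIdeal) (hTgood : ∀ v ∈ T, W.HasGoodReductionAt v)
    (hTram : ∀ v ∈ T, closureEmb (K := K) (v.adicCompletion K) (geomSqrt d) ∉ maxUnramified (v.adicCompletion K))
    (hTt : ∀ v ∈ T, Nat.card (nsmulAddMonoidHom 2 : (W.baseChange (v.adicCompletion K)).toAffine.Point →+ _).ker = 2 ^ e v)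
    (hR : ∀ w ∈ R, ∃ hw : w.IsReal, 0 < InfinitePlace.embedding_of_isReal hw W.Δ)
    (hRd : ∀ w ∈ R, ∀ s : w.Completion, s ^ 2 ≠ algebraMap K w.Completion d)
    (hfin : ∀ v : HeightOneSpectrum (𝓞 K), v ∉ T →
      (∃ s : v.adicCompletion K, s ^ 2 = algebraMap K (v.adicCompletion K) d) ∨
      (((2 : ℕ) : 𝓞 K) ∉ v.asIdeal ∧
        ¬ 2 ∣ (W.baseChange (v.adicCompletion K)).localTamagawaNumber (v.adicCompletionIntegers K) ∧
        ¬ 2 ∣ (Wd.baseChange (v.adicCompletion K)).localTamagawaNumber (v.adicCompletionIntegers K)) ∨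
      (((2 : ℕ) : 𝓞 K) ∉ v.asIdeal ∧ W.HasGoodReductionAt v ∧ Wd.HasGoodReductionAt v) ∨
      (((2 : ℕ) : 𝓞 K) ∉ v.asIdeal ∧
        Nat.card (nsmulAddMonoidHom 2 : (W.baseChange (v.adicCompletion K)).toAffine.Point →+ _).ker = 1 ∧
        Nat.card (nsmulAddMonoidHom 2 : (Wd.baseChange (v.adicCompletion K)).toAffine.Point →+ _).ker = 1) ∨
      ((W.HasGoodReductionAt v ∨ (W.HasMultiplicativeReductionAt v ∧ Odd (W.ordMinimalDiscriminant v))) ∧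
        closureEmb (K := K) (v.adicCompletion K) (geomSqrt d) ∈ maxUnramified (v.adicCompletion K)))
    (hinf : ∀ w : InfinitePlace K, w ∉ R →
      (∃ s : w.Completion, s ^ 2 = algebraMap K w.Completion d) ∨
      ((∀ x : galoisCohomology (W.localGaloisModule w.Completion) 1, x = 0) ∧
        (∀ x : galoisCohomology (Wd.localGaloisModule w.Completion) 1, x = 0))) :
    Nat.card (Wd.selmerGroup ((2 : ℕ) : ℤ)) ≤ 2 ^ (∑ v ∈ T, e v + R.card) * Nat.card (W.selmerGroup ((2 : ℕ) : ℤ)) ∧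
    Nat.card (W.selmerGroup ((2 : ℕ) : ℤ)) ≤ 2 ^ (∑ v ∈ T, e v + R.card) * Nat.card (Wd.selmerGroup ((2 : ℕ) : ℤ)) ∧
    IsSquare (Nat.card (Wd.selmerGroup ((2 : ℕ) : ℤ)) * Nat.card (W.selmerGroup ((2 : ℕ) : ℤ)) * 2 ^ (∑ v ∈ T, e v + R.card)) := by
  haveI : Fact (Nat.Prime 2) := ⟨Nat.prime_two⟩
  -- the master identification: split agreement, unramified semistable row, Lemma 2.11, real transversality, frame datum
  obtain ⟨φ, ψ, hψφ, hφψ, hsplit, hunr, htr, hreal, π, A, hπ, hA⟩ := exists_intertwining_master_frame W Wd hd hWd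
  let 𝓐 : SelmerStructure (W.torsionGaloisModule ((2 : ℕ) : ℤ)) := fun v ↦
    (Wd.kummerSelmerStructure ((2 : ℕ) : ℤ) v).map (galoisCohomology.map (φ.restrictField (Place.Completion v)) 1)
  have h𝓐 : ∀ v, 𝓐 v = (Wd.kummerSelmerStructure ((2 : ℕ) : ℤ) v).map
      (galoisCohomology.map (φ.restrictField (Place.Completion v)) 1) := fun _ ↦ rfl
  -- the `T`-places and `R`-places as one finite set of places
  let SR : Finset (Place K) := R.map ⟨Sum.inl, Sum.inl_injective⟩
  let ST : Finset (Place K) := T.map ⟨Sum.inr, Sum.inr_injective⟩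
  let S : Finset (Place K) := SR ∪ ST
  have hdisj : Disjoint SR ST := by
    rw [Finset.disjoint_left]
    intro x hx hx'
    obtain ⟨w, -, rfl⟩ := Finset.mem_map.mp hx
    obtain ⟨v, -, hv⟩ := Finset.mem_map.mp hx'
    exact Sum.inr_ne_inl hv
  have hmem_inl : ∀ w : InfinitePlace K, (Sum.inl w : Place K) ∈ S → w ∈ R := by
    intro w hw
    rcases Finset.mem_union.mp hw with h | h
    · obtain ⟨w', hw', hww⟩ := Finset.mem_map.mp h
      exact Sum.inl_injective hww ▸ hw'
    · obtain ⟨v, -, hv⟩ := Finset.mem_map.mp h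
      exact absurd hv Sum.inr_ne_inl
  have hmem_inr : ∀ v : HeightOneSpectrum (𝓞 K), (Sum.inr v : Place K) ∈ S → v ∈ T := by
    intro v hv
    rcases Finset.mem_union.mp hv with h | h
    · obtain ⟨w, -, hw⟩ := Finset.mem_map.mp h
      exact absurd hw Sum.inl_ne_inr
    · obtain ⟨v', hv', hvv⟩ := Finset.mem_map.mp h
      exact Sum.inr_injective hvv ▸ hv'
  -- agreement off `S` from the menus
  have hagree : ∀ v ∉ S, 𝓐 v = W.kummerSelmerStructure ((2 : ℕ) : ℤ) v := by
    rintro (w | v) hv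
    · exact transport_twist_agree_inl_of_menu W φ ψ hφψ hsplit 𝓐 h𝓐 w (hinf w fun h ↦ hv (by
        exact Finset.mem_union.mpr (Or.inl (Finset.mem_map.mpr ⟨w, h, rfl⟩))))
    · exact transport_twist_agree_inr_of_menu₅ W φ ψ hφψ hsplit hunr 𝓐 h𝓐 v (hfin v fun h ↦ hv (by
        exact Finset.mem_union.mpr (Or.inr (Finset.mem_map.mpr ⟨v, h, rfl⟩))))
  -- the local counts at the `T`-places: `#𝓚_v = #𝓐_v = 2^{e_v}`, `[𝓚_v : 𝓐_v ⊓ 𝓚_v] = 2^{e_v}`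
  have hKv : ∀ v ∈ T, Nat.card (W.kummerSelmerStructure ((2 : ℕ) : ℤ) (Sum.inr v)) = 2 ^ e v := fun v hv ↦ by
    rw [W.natCard_kummerSelmerStructure_inr v two_ne_zero, hTt v hv, natCard_quotient_span_natCast_eq_one_of_not_mem v (hT2 v hv),
      mul_one]
  have hAv : ∀ v ∈ T, Nat.card (𝓐 (Sum.inr v)) = 2 ^ e v := fun v hv ↦ by
    haveI : CharZero (v.adicCompletion K) := charZero_of_injective_algebraMap (algebraMap K _).injective
    have h1 : Nat.card (𝓐 (Sum.inr v)) = Nat.card (Wd.kummerSelmerStructure ((2 : ℕ) : ℤ) (Sum.inr v)) := by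
      rw [h𝓐]
      exact Nat.card_congr (AddSubgroup.equivMapOfInjective _ _
        (map_restrictField_injective_of_comp_eq φ ψ hψφ (Sum.inr v))).toEquiv.symm
    rw [h1, Wd.natCard_kummerSelmerStructure_inr v two_ne_zero,
      natCard_ker_nsmul_eq_of_intertwining W Wd 2 two_ne_zero φ ψ hψφ hφψ (v.adicCompletion K), hTt v hv,
      natCard_quotient_span_natCast_eq_one_of_not_mem v (hT2 v hv), mul_one]
  have hrelv : ∀ v ∈ T, (𝓐 (Sum.inr v)).relIndex (W.kummerSelmerStructure ((2 : ℕ) : ℤ) (Sum.inr v)) = 2 ^ e v :=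
    fun v hv ↦ by
    have htr' : 𝓐 (Sum.inr v) ⊓ W.kummerSelmerStructure ((2 : ℕ) : ℤ) (Sum.inr v) = ⊥ := by
      rw [h𝓐, kummerSelmerStructure_apply, kummerSelmerStructure_apply]
      exact htr v (hTgood v hv) (hT2 v hv) (hTram v hv)
    rw [← AddSubgroup.inf_relIndex_right, htr', AddSubgroup.relIndex_bot_left]
    exact hKv v hv
  -- the local counts at the `R`-places: `#𝓚_w = #𝓐_w = 2`, `[𝓚_w : 𝓐_w ⊓ 𝓚_w] = 2`
  have hKw : ∀ w ∈ R, Nat.card (W.kummerSelmerStructure ((2 : ℕ) : ℤ) (Sum.inl w)) = 2 := fun w hw ↦ by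
    obtain ⟨hwr, hΔw⟩ := hR w hw
    exact natCard_kummerSelmerStructure_inl_eq_two_of_isReal W hwr hΔw
  have hAw : ∀ w ∈ R, Nat.card (𝓐 (Sum.inl w)) = 2 := fun w hw ↦ by
    obtain ⟨hwr, hΔw⟩ := hR w hw
    have h1 : Nat.card (𝓐 (Sum.inl w)) = Nat.card (Wd.kummerSelmerStructure ((2 : ℕ) : ℤ) (Sum.inl w)) := by
      rw [h𝓐]
      exact Nat.card_congr (AddSubgroup.equivMapOfInjective _ _
        (map_restrictField_injective_of_comp_eq φ ψ hψφ (Sum.inl w))).toEquiv.symm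
    rw [h1]
    exact natCard_kummerSelmerStructure_inl_eq_two_of_isReal Wd hwr (embedding_Δ_pos_of_smul_quadraticTwist W Wd hd hWd hwr hΔw)
  have hrelw : ∀ w ∈ R, (𝓐 (Sum.inl w)).relIndex (W.kummerSelmerStructure ((2 : ℕ) : ℤ) (Sum.inl w)) = 2 := fun w hw ↦ by
    obtain ⟨hwr, hΔw⟩ := hR w hw
    have htr' : 𝓐 (Sum.inl w) ⊓ W.kummerSelmerStructure ((2 : ℕ) : ℤ) (Sum.inl w) = ⊥ := by
      rw [h𝓐, kummerSelmerStructure_apply, kummerSelmerStructure_apply]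
      exact hreal w hwr hΔw (hRd w hw)
    rw [← AddSubgroup.inf_relIndex_right, htr', AddSubgroup.relIndex_bot_left]
    exact hKw w hw
  -- products over `S`
  have hprod : ∀ f : Place K → ℕ, (∀ w ∈ R, f (Sum.inl w) = 2) → (∀ v ∈ T, f (Sum.inr v) = 2 ^ e v) →
      ∏ x ∈ S, f x = 2 ^ (∑ v ∈ T, e v + R.card) := by
    intro f hfR hfT
    have h1 : ∏ x ∈ SR, f x = 2 ^ R.card := by
      rw [Finset.prod_map, Finset.prod_congr rfl (fun w hw ↦ ?_), Finset.prod_const]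
      exact hfR w hw
    have h2 : ∏ x ∈ ST, f x = 2 ^ ∑ v ∈ T, e v := by
      rw [Finset.prod_map, Finset.prod_congr rfl (fun v hv ↦ ?_), Finset.prod_pow_eq_pow_sum]
      exact hfT v hv
    rw [Finset.prod_union hdisj, h1, h2, ← pow_add, add_comm]
  -- Selmer cardinalities
  have hSelA : Nat.card 𝓐.selmerGroup = Nat.card (Wd.selmerGroup ((2 : ℕ) : ℤ)) :=
    natCard_selmerGroup_transport_kummer W Wd 2 φ ψ hψφ hφψ 𝓐 h𝓐
  have hSelK : Nat.card (W.kummerSelmerStructure ((2 : ℕ) : ℤ)).selmerGroup = Nat.card (W.selmerGroup ((2 : ℕ) : ℤ)) := by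
    rw [selmerGroup_eq_selmerGroup_kummerSelmerStructure]
    rfl
  have hfinW : Finite (W.selmerGroup ((2 : ℕ) : ℤ)) := W.finite_selmerGroup_holds (by norm_num)
  have hfinWd : Finite (Wd.selmerGroup ((2 : ℕ) : ℤ)) := Wd.finite_selmerGroup_holds (by norm_num)
  haveI hfinK : Finite (W.kummerSelmerStructure ((2 : ℕ) : ℤ)).selmerGroup := by
    rw [← selmerGroup_eq_selmerGroup_kummerSelmerStructure]; exact hfinW
  haveI hfinA : Finite 𝓐.selmerGroup :=
    Nat.finite_of_card_ne_zero (by rw [hSelA]; exact (Nat.card_pos (α := Wd.selmerGroup ((2 : ℕ) : ℤ))).ne')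
  have hprodA : ∏ v ∈ S, Nat.card (𝓐 v) = 2 ^ (∑ v ∈ T, e v + R.card) := hprod _ hAw hAv
  have hprodK : ∏ v ∈ S, Nat.card (W.kummerSelmerStructure ((2 : ℕ) : ℤ) v) = 2 ^ (∑ v ∈ T, e v + R.card) := hprod _ hKw hKv
  have hprodrel : ∏ v ∈ S, (𝓐 v).relIndex (W.kummerSelmerStructure ((2 : ℕ) : ℤ) v) = 2 ^ (∑ v ∈ T, e v + R.card) :=
    hprod _ hrelw hrelv
  refine ⟨?_, ?_, ?_⟩
  · -- `#Sel(Wd) ≤ 2ⁿ · #Sel(W)`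
    have h := natCard_selmerGroup_le_mul_prod_of_agree_off W 2 𝓐 (W.kummerSelmerStructure ((2 : ℕ) : ℤ)) S hagree
    rw [hSelA, hSelK, hprodA, mul_comm] at h
    exact h
  · -- `#Sel(W) ≤ 2ⁿ · #Sel(Wd)`
    have h := natCard_selmerGroup_le_mul_prod_of_agree_off W 2 (W.kummerSelmerStructure ((2 : ℕ) : ℤ)) 𝓐 S
      (fun v hv ↦ (hagree v hv).symm)
    rw [hSelA, hSelK, hprodK, mul_comm] at h
    exact h
  · -- the parity: Kramer's congruence for the framed `φ`
    have h := GenusKolyKramer.isSquare_card_selmerGroup_mul_of_frame W Wd φ (Function.LeftInverse.injective hψφ) π hπ A hA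
      𝓐 h𝓐 S hagree
    rw [hprodrel] at h
    exact h

end Mixed

/-! ## §114 Over `ℚ` with `Δ_W > 0`, `d < 0`: the real place is the extra `T`-place -/

section Rat

variable (W Wd : WeierstrassCurve ℚ) [W.IsElliptic] [Wd.IsElliptic]

/-- **Prop. 3.3's bounds over `ℚ` for a NEGATIVE twist parameter of a curve with `Δ_W > 0`** — the real place is a `T`-place (Kramer
Prop. 6: `i_∞ = 1`): `T` a finite set of odd good primes (as places) ramified in `ℚ(√d)` with `#W(ℚ_v)[2] = 2^{e_v}`, every finite `v ∉ T` on
the five-row menu ⟹ with `n = Σ e_v + 1`: `#Sel₂(Wd) ≤ 2ⁿ·#Sel₂(W)`, `#Sel₂(W) ≤ 2ⁿ·#Sel₂(Wd)`, `IsSquare (#Sel₂(Wd)·#Sel₂(W)·2ⁿ)`.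
For `T = ∅` this is the T-A dichotomy's parity and bound; for `T = {q₀}` (a transposition prime) `d₂(Wd) ≡ d₂(W) (mod 2)` and
`|d₂(Wd) − d₂(W)| ≤ 2`. Unconditional. [cite: MazurRubin2010, Prop. 3.3, proof of Prop. 5.3] [cite: Kramer1981, Thm. 1, Prop. 6] -/
theorem natCard_selmerGroup_twist_bounds_rat_of_Δ_pos (hΔ : 0 < W.Δ) {d : ℚ} (hd : d < 0) {C : VariableChange ℚ}
    (hWd : C • W.quadraticTwist d = Wd) (T : Finset (HeightOneSpectrum (𝓞 ℚ))) (e : HeightOneSpectrum (𝓞 ℚ) → ℕ)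
    (hT2 : ∀ v ∈ T, ((2 : ℕ) : 𝓞 ℚ) ∉ v.asIdeal) (hTgood : ∀ v ∈ T, W.HasGoodReductionAt v)
    (hTram : ∀ v ∈ T, closureEmb (K := ℚ) (v.adicCompletion ℚ) (geomSqrt d) ∉ maxUnramified (v.adicCompletion ℚ))
    (hTt : ∀ v ∈ T, Nat.card (nsmulAddMonoidHom 2 : (W.baseChange (v.adicCompletion ℚ)).toAffine.Point →+ _).ker = 2 ^ e v)
    (hfin : ∀ v : HeightOneSpectrum (𝓞 ℚ), v ∉ T →
      (∃ s : v.adicCompletion ℚ, s ^ 2 = algebraMap ℚ (v.adicCompletion ℚ) d) ∨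
      (((2 : ℕ) : 𝓞 ℚ) ∉ v.asIdeal ∧
        ¬ 2 ∣ (W.baseChange (v.adicCompletion ℚ)).localTamagawaNumber (v.adicCompletionIntegers ℚ) ∧
        ¬ 2 ∣ (Wd.baseChange (v.adicCompletion ℚ)).localTamagawaNumber (v.adicCompletionIntegers ℚ)) ∨
      (((2 : ℕ) : 𝓞 ℚ) ∉ v.asIdeal ∧ W.HasGoodReductionAt v ∧ Wd.HasGoodReductionAt v) ∨
      (((2 : ℕ) : 𝓞 ℚ) ∉ v.asIdeal ∧
        Nat.card (nsmulAddMonoidHom 2 : (W.baseChange (v.adicCompletion ℚ)).toAffine.Point →+ _).ker = 1 ∧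
        Nat.card (nsmulAddMonoidHom 2 : (Wd.baseChange (v.adicCompletion ℚ)).toAffine.Point →+ _).ker = 1) ∨
      ((W.HasGoodReductionAt v ∨ (W.HasMultiplicativeReductionAt v ∧ Odd (W.ordMinimalDiscriminant v))) ∧
        closureEmb (K := ℚ) (v.adicCompletion ℚ) (geomSqrt d) ∈ maxUnramified (v.adicCompletion ℚ))) :
    Nat.card (Wd.selmerGroup ((2 : ℕ) : ℤ)) ≤ 2 ^ (∑ v ∈ T, e v + 1) * Nat.card (W.selmerGroup ((2 : ℕ) : ℤ)) ∧
    Nat.card (W.selmerGroup ((2 : ℕ) : ℤ)) ≤ 2 ^ (∑ v ∈ T, e v + 1) * Nat.card (Wd.selmerGroup ((2 : ℕ) : ℤ)) ∧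
    IsSquare (Nat.card (Wd.selmerGroup ((2 : ℕ) : ℤ)) * Nat.card (W.selmerGroup ((2 : ℕ) : ℤ)) * 2 ^ (∑ v ∈ T, e v + 1)) := by
  have hw₀ : (Rat.infinitePlace).IsReal := Rat.isReal_infinitePlace
  have hΔ' : 0 < InfinitePlace.embedding_of_isReal hw₀ W.Δ := by rwa [embedding_of_isReal_rat_apply, Rat.cast_pos]
  have hR : ∀ w ∈ ({Rat.infinitePlace} : Finset (InfinitePlace ℚ)), ∃ hw : w.IsReal, 0 < InfinitePlace.embedding_of_isReal hw W.Δ := by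
    intro w hw
    rw [Finset.mem_singleton] at hw
    subst hw
    exact ⟨hw₀, hΔ'⟩
  have hRd : ∀ w ∈ ({Rat.infinitePlace} : Finset (InfinitePlace ℚ)), ∀ s : w.Completion, s ^ 2 ≠ algebraMap ℚ w.Completion d :=
    fun w _ ↦ forall_sq_ne_completion_of_neg hd w
  have hinf : ∀ w : InfinitePlace ℚ, w ∉ ({Rat.infinitePlace} : Finset (InfinitePlace ℚ)) →
      (∃ s : w.Completion, s ^ 2 = algebraMap ℚ w.Completion d) ∨
      ((∀ x : galoisCohomology (W.localGaloisModule w.Completion) 1, x = 0) ∧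
        (∀ x : galoisCohomology (Wd.localGaloisModule w.Completion) 1, x = 0)) :=
    fun w hw ↦ absurd (Finset.mem_singleton.mpr (Subsingleton.elim w _)) hw
  have h := natCard_selmerGroup_twist_bounds_mixed W Wd hd.ne hWd T e {Rat.infinitePlace} hT2 hTgood hTram hTt hR hRd hfin hinf
  rwa [Finset.card_singleton] at h

end Rat

end Summit.BirchSwinnertonDyer.BirchSwinnertonDyer.Theorems.GenusKolyTwistLocal

end
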